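import Summits.ABC.ABC.Theses.DefiniteXi
import Literature.NumberTheory.EllipticCurves.CongruenceNumber
import Literature.NumberTheory.EllipticCurves.PastenSpectralDegree
import Literature.NumberTheory.EllipticCurves.PastenCongruenceModulusProofs
import Literature.NumberTheory.EllipticCurves.ModularSymbolRep

/-!
# Crux FreyDegreeBound (stmt-ABC-2019) — ideator 1 sketch: first lemmas of the three idea cards

All statements are over existing declarations; proofs only where cheap (glue).
-/

noncomputable section

open scoped MatrixGroups ModularForm
open CongruenceSubgroup

namespace Summit.ABC.ABC.Cruxes.FreyDegreeBound.Ideator1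

open Literature.NumberTheory.EllipticCurves
open Literature.NumberTheory.EllipticCurves.ModularForms

/-- The conclusion every line feeds into the route's proved glue `MinimalBoundGivesTarget`:
the degree bound for MINIMAL-degree data of Frey curves (verbatim the second antecedent of
`Summit.ABC.ABC.Theses.DefiniteXi.MinimalBoundGivesTarget`). -/
def MinimalFreyDegreeBound : Prop :=
  ∀ ε : ℝ, 0 < ε → ∃ C : ℝ, ∀ a b : ℤ, IsCoprime a b → a * b * (a + b) ≠ 0 → ∀ (N : ℕ) [NeZero N],
    (freyCurve a b).conductorNorm ℤ = N →
      ∀ D : ModularParametrizationData (freyCurve a b) N,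
        (∀ D' : ModularParametrizationData (freyCurve a b) N, D.deg ≤ D'.deg) →
          (D.deg : ℝ) ≤ C * (N : ℝ) ^ (2 + ε)

/-- Sanity: the route glue consumes exactly this shape. -/
example (hMod : Summit.ABC.ABC.Theses.DefiniteXi.FreyModularity)
    (hMin : Summit.ABC.ABC.Theses.DefiniteXi.MinimalBoundGivesTarget)
    (h : MinimalFreyDegreeBound) : Summit.ABC.ABC.Theses.DefiniteXi.FreyDegreeBound :=
  hMin hMod h

/-! ## Card `two-adic-ledger`: split of deg φ into its 2-part (cuspidal ledger) and its odd part -/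

/-- `TwoAdicLaw θ`: the 2-part of the minimal modular degree of a Frey curve is `≪_ε N^(θ+ε)`. -/
def TwoAdicLaw (θ : ℝ) : Prop :=
  ∀ ε : ℝ, 0 < ε → ∃ C : ℝ, ∀ a b : ℤ, IsCoprime a b → a * b * (a + b) ≠ 0 → ∀ (N : ℕ) [NeZero N],
    (freyCurve a b).conductorNorm ℤ = N →
      ∀ D : ModularParametrizationData (freyCurve a b) N,
        (∀ D' : ModularParametrizationData (freyCurve a b) N, D.deg ≤ D'.deg) →
          ((ordProj[2] D.deg : ℕ) : ℝ) ≤ C * (N : ℝ) ^ (θ + ε)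

/-- `OddLaw θ`: the odd part of the minimal modular degree of a Frey curve is `≪_ε N^(2−θ+ε)`. -/
def OddLaw (θ : ℝ) : Prop :=
  ∀ ε : ℝ, 0 < ε → ∃ C : ℝ, ∀ a b : ℤ, IsCoprime a b → a * b * (a + b) ≠ 0 → ∀ (N : ℕ) [NeZero N],
    (freyCurve a b).conductorNorm ℤ = N →
      ∀ D : ModularParametrizationData (freyCurve a b) N,
        (∀ D' : ModularParametrizationData (freyCurve a b) N, D.deg ≤ D'.deg) →
          ((ordCompl[2] D.deg : ℕ) : ℝ) ≤ C * (N : ℝ) ^ (2 - θ + ε)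

/-- FIRST LEMMA of `two-adic-ledger` (regime glue, proved): for any splitting exponent `θ`,
`TwoAdicLaw θ ∧ OddLaw θ` give the minimal-degree bound, hence (route glue) `FreyDegreeBound`. -/
theorem minimalFreyDegreeBound_of_laws (θ : ℝ) (h2 : TwoAdicLaw θ) (hodd : OddLaw θ) :
    MinimalFreyDegreeBound := by
  intro ε hε
  obtain ⟨C₁, hC₁⟩ := h2 (ε / 2) (by linarith)
  obtain ⟨C₂, hC₂⟩ := hodd (ε / 2) (by linarith)
  refine ⟨max C₁ 0 * max C₂ 0, ?_⟩
  intro a b hab h0 N _ hN D hmin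
  have hA := hC₁ a b hab h0 N hN D hmin
  have hB := hC₂ a b hab h0 N hN D hmin
  have hNpos : (0 : ℝ) < (N : ℝ) := by exact_mod_cast Nat.pos_of_ne_zero (NeZero.ne N)
  have hdeg : (D.deg : ℝ) = ((ordProj[2] D.deg : ℕ) : ℝ) * ((ordCompl[2] D.deg : ℕ) : ℝ) := by
    exact_mod_cast (Nat.ordProj_mul_ordCompl_eq_self D.deg 2).symm
  have hA' : ((ordProj[2] D.deg : ℕ) : ℝ) ≤ max C₁ 0 * (N : ℝ) ^ (θ + ε / 2) :=
    hA.trans (mul_le_mul_of_nonneg_right (le_max_left _ _) (Real.rpow_nonneg hNpos.le _))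
  have hB' : ((ordCompl[2] D.deg : ℕ) : ℝ) ≤ max C₂ 0 * (N : ℝ) ^ (2 - θ + ε / 2) :=
    hB.trans (mul_le_mul_of_nonneg_right (le_max_left _ _) (Real.rpow_nonneg hNpos.le _))
  have hpow : (N : ℝ) ^ (θ + ε / 2) * (N : ℝ) ^ (2 - θ + ε / 2) = (N : ℝ) ^ (2 + ε) := by
    rw [← Real.rpow_add hNpos]; ring_nf
  calc (D.deg : ℝ) = ((ordProj[2] D.deg : ℕ) : ℝ) * ((ordCompl[2] D.deg : ℕ) : ℝ) := hdeg
    _ ≤ (max C₁ 0 * (N : ℝ) ^ (θ + ε / 2)) * (max C₂ 0 * (N : ℝ) ^ (2 - θ + ε / 2)) :=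
        mul_le_mul hA' hB' (by positivity) (by positivity)
    _ = max C₁ 0 * max C₂ 0 * ((N : ℝ) ^ (θ + ε / 2) * (N : ℝ) ^ (2 - θ + ε / 2)) := by ring
    _ = max C₁ 0 * max C₂ 0 * (N : ℝ) ^ (2 + ε) := by rw [hpow]

/-! ## Card `pasten-total-depth`: deg φ | ∏ Hecke congruence moduli (Pasten Thm 5.5, in tree) -/

/-- `TotalDepth`: the product over the other eigen-systems `[χ] ≠ [χ_{f_E}]` of Pasten's congruence
moduli `η_{[f_E]}([χ])` is `≪_ε N^(2+ε)` for the newform of a Frey curve (equivalently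
`Σ_P log η(P) ≤ (2+ε) log N + O_ε(1)`). The abc-strength item of the line. -/
def TotalDepth : Prop :=
  ∀ ε : ℝ, 0 < ε → ∃ C : ℝ, ∀ a b : ℤ, IsCoprime a b → a * b * (a + b) ≠ 0 → ∀ (N : ℕ) [NeZero N],
    (freyCurve a b).conductorNorm ℤ = N →
      ∀ D : ModularParametrizationData (freyCurve a b) N,
        ((∏ P ∈ ((finite_minimalPrimes_anemicHeckeRing N 2).toFinset.erase (eigenIdeal D.f)),
            heckeCongruenceModulus D.f P : ℕ) : ℝ) ≤ C * (N : ℝ) ^ (2 + ε)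

/-- FIRST LEMMA of `pasten-total-depth` (proved modulo the tree's named fact
`PastenShimura2024_thm_5_5`): Pasten's divisibility turns `TotalDepth` into the minimal-degree bound.
The minimality hypothesis of Thm 5.5 is over ALL elliptic `W'` with the same newform; a datum of
minimal degree among Frey data of `freyCurve a b` need not be minimal in that wider sense, so the
line carries the comparison as an explicit (known: isogeny-class, Mazur–Kenku `≤ 163`) input
`hopt`. -/
theorem minimalFreyDegreeBound_of_totalDepth
    (h55 : PastenShimura2024_thm_5_5) (hT : TotalDepth)
    (hopt : ∀ a b : ℤ, IsCoprime a b → a * b * (a + b) ≠ 0 → ∀ (N : ℕ) [NeZero N],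
      (freyCurve a b).conductorNorm ℤ = N → ∀ D : ModularParametrizationData (freyCurve a b) N,
        (∀ D' : ModularParametrizationData (freyCurve a b) N, D.deg ≤ D'.deg) →
        ∃ (N' : ℕ) (_ : NeZero N') (W : WeierstrassCurve ℚ) (_ : W.IsElliptic)
          (D₀ : ModularParametrizationData W N'), N' = N ∧
          (∀ (W' : WeierstrassCurve ℚ) [W'.IsElliptic] (D' : ModularParametrizationData W' N'),
              D'.f = D₀.f → D₀.modularDegree ≤ D'.modularDegree) ∧
          D.deg ≤ 163 * D₀.modularDegree ∧
          ((∏ P ∈ ((finite_minimalPrimes_anemicHeckeRing N' 2).toFinset.erase (eigenIdeal D₀.f)),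
              heckeCongruenceModulus D₀.f P : ℕ) : ℝ) ≤
            ((∏ P ∈ ((finite_minimalPrimes_anemicHeckeRing N 2).toFinset.erase (eigenIdeal D.f)),
              heckeCongruenceModulus D.f P : ℕ) : ℝ)) :
    MinimalFreyDegreeBound := by
  intro ε hε
  obtain ⟨C, hC⟩ := hT ε hε
  refine ⟨163 * max C 0, ?_⟩
  intro a b hab h0 N _ hN D hmin
  obtain ⟨N', hN', W, hW, D₀, rfl, hmin₀, hcmp, hprod⟩ := hopt a b hab h0 N hN D hmin
  have hdvd := h55 N' W D₀ hmin₀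
  have hpos : 0 < ∏ P ∈ ((finite_minimalPrimes_anemicHeckeRing N' 2).toFinset.erase (eigenIdeal D₀.f)),
      heckeCongruenceModulus D₀.f P :=
    ModularParametrizationData.prod_heckeCongruenceModulus_pos D₀
  have hle : D₀.modularDegree ≤ ∏ P ∈ ((finite_minimalPrimes_anemicHeckeRing N' 2).toFinset.erase
      (eigenIdeal D₀.f)), heckeCongruenceModulus D₀.f P := Nat.le_of_dvd hpos hdvd
  have hT' := hC a b hab h0 N' hN D
  have hNpos : (0 : ℝ) < (N' : ℝ) := by exact_mod_cast Nat.pos_of_ne_zero (NeZero.ne N')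
  calc (D.deg : ℝ) ≤ 163 * (D₀.modularDegree : ℝ) := by exact_mod_cast hcmp
    _ ≤ 163 * ((∏ P ∈ ((finite_minimalPrimes_anemicHeckeRing N' 2).toFinset.erase (eigenIdeal D₀.f)),
          heckeCongruenceModulus D₀.f P : ℕ) : ℝ) :=
        mul_le_mul_of_nonneg_left (by exact_mod_cast hle) (by norm_num)
    _ ≤ 163 * (C * (N' : ℝ) ^ (2 + ε)) := mul_le_mul_of_nonneg_left (hprod.trans hT') (by norm_num)
    _ ≤ 163 * (max C 0 * (N' : ℝ) ^ (2 + ε)) :=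
        mul_le_mul_of_nonneg_left
          (mul_le_mul_of_nonneg_right (le_max_left _ _) (Real.rpow_nonneg hNpos.le _)) (by norm_num)
    _ = 163 * max C 0 * (N' : ℝ) ^ (2 + ε) := by ring

/-! ## Card `manin-supnorm-frey`: Merel/Cremona intersection bound shape (signature only) -/

/-- `ManinSupNormShape`: the first checkable statement of the Manin-symbol line — an absolute `κ`
such that, whenever the (torsion-cleared, Manin-scaled) unimodular symbols
`t · c · ⟨g⟩_f = t c · 2πi ∫_{g0}^{g∞} f`, `g ∈ SL₂(ℤ)`, have integer coordinates of absolute value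
`≤ M⁺` resp. `≤ M⁻` on a RECTANGULAR basis `(λ⁺, i λ⁻)` of the Néron lattice (Frey curves have
`Δ > 0`), the minimal degree is `≤ κ · ψ(N) · M⁺ · M⁻` (Cremona (2.x): `deg φ = |γ⁺ · γ⁻|`;
Merel 1993: the intersection form on Manin symbols has `O(1)` partners per symbol). -/
def ManinSupNormShape : Prop :=
  ∃ κ : ℝ, ∀ a b : ℤ, IsCoprime a b → a * b * (a + b) ≠ 0 → ∀ (N : ℕ) [NeZero N],
    (freyCurve a b).conductorNorm ℤ = N →
      ∀ D : ModularParametrizationData (freyCurve a b) N,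
        (∀ D' : ModularParametrizationData (freyCurve a b) N, D.deg ≤ D'.deg) →
        ∀ (t Mp Mm : ℕ) (lp lm : ℝ), 0 < t → 0 < lp → 0 < lm →
          D.L.lattice = Submodule.span ℤ {(lp : ℂ), (lm : ℂ) * Complex.I} →
          (∀ g : SL(2, ℤ), ∃ m n : ℤ, |m| ≤ Mp ∧ |n| ≤ Mm ∧
              (t : ℂ) * ((D.c : ℂ) * unimodularSymbol D.f g) = m * (lp : ℂ) + n * ((lm : ℂ) * Complex.I)) →
          (D.deg : ℝ) ≤ κ * (gamma0Index N : ℝ) * Mp * Mm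

/-- The sup-norm conjecture SN of the line, in the same currency: the coordinates themselves are
`≪_ε N^(1/2+ε)` (for SOME admissible `t ≤ N^ε`). With `ManinSupNormShape` it gives the minimal
degree bound `≪ N^(1+o(1)) · N^(1+2ε)`. -/
def ManinSupNormConjecture : Prop :=
  ∀ ε : ℝ, 0 < ε → ∃ C : ℝ, ∀ a b : ℤ, IsCoprime a b → a * b * (a + b) ≠ 0 → ∀ (N : ℕ) [NeZero N],
    (freyCurve a b).conductorNorm ℤ = N →
      ∀ D : ModularParametrizationData (freyCurve a b) N,
        (∀ D' : ModularParametrizationData (freyCurve a b) N, D.deg ≤ D'.deg) →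
        ∃ (t Mp Mm : ℕ) (lp lm : ℝ), 0 < t ∧ 0 < lp ∧ 0 < lm ∧ (t : ℝ) ≤ C * (N : ℝ) ^ ε ∧
          D.L.lattice = Submodule.span ℤ {(lp : ℂ), (lm : ℂ) * Complex.I} ∧
          (∀ g : SL(2, ℤ), ∃ m n : ℤ, |m| ≤ Mp ∧ |n| ≤ Mm ∧
              (t : ℂ) * ((D.c : ℂ) * unimodularSymbol D.f g) = m * (lp : ℂ) + n * ((lm : ℂ) * Complex.I)) ∧
          (Mp : ℝ) ≤ C * (N : ℝ) ^ (1 / 2 + ε) ∧ (Mm : ℝ) ≤ C * (N : ℝ) ^ (1 / 2 + ε)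

end Summit.ABC.ABC.Cruxes.FreyDegreeBound.Ideator1
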